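import Summits.QuantumFields.YangMills.Theorems.FluctuationComparisonRegPrIntLOrganTangentFibreMeanVersionKnit
import Summits.QuantumFields.YangMills.Theorems.BalabanUVNodesN09DomAltThresholdNull
import Literature.MathematicalPhysics.QuantumFieldTheory.Balaban1983to89.T3UnitScaleTilt
import Literature.MathematicalPhysics.QuantumFieldTheory.Balaban1983to89.T3UnitLawDensityEML
import Literature.MathematicalPhysics.QuantumFieldTheory.Balaban1983to89.T3OrbitAverage
import HarnessLib

/-!
# Crux `FluctuationComparisonRegPrIntL` (stmt-QuantumFields-20520, rung R3), PATH-B organ-tangent lane, row VER∘ `FibreMeanVersionCan` —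
# THE KNIT «VER∘ ⟸ (A1)(A2)(A3)», GENERIC-CUT EDITION of ✓`…OrganTangentFibreMeanVersionKnit` (p781950 v3 + p782690 v4; LEAD w3 g22): `3 ∕ 4 ↦ cW`

LEAD-20520 width seat ym-ust-20520-w3 g23 (cell ym3-torus), `--supports stmt-QuantumFields-20520` (helper).  THEOREMS ONLY, def-free; statements and
proofs are those of the landed knit BYTE FOR BYTE except that the window constant `3 ∕ 4` is the binder `(cW : ℝ) (hcW : cW < 1)` (`cW < 1` is used
exactly where the `cW`-window must sit inside the open fine window `{PlaqSmall θ_{j+1}}`: `tsupport_subset_plaqSmall`, `O₃ ⊆ O`).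

WHY A GENERIC-CUT EDITION (R-CUT-χ, LEAD WORD №1 (iii) ∕ ideator ym-r3-idea-1 g26 №3 «GO v2.6 ∕ v17.2», 2026-08-30).  Row VER∘ needs every
coarse-window fibre of `descend` to meet `{χ > 0} = {PlaqSmall (c₂·θ_{j+1})}`, `c₂θ` the TOP of the cutoff ramp — i.e. exact one-step small lifts with
gain `κ√L ≤ c₂` from a height.  The tree's certified kernels give `κ√L ≤ 0.9482…` at `L = 3` (`CertL3Tree.certL3_clause`), `0.860 ∕ 0.805` at
`L = 5 ∕ 7` (ANSATZ S), `≤ 2∕3` for odd `L ≥ 9` (ANSATZ T): the v2–v2.5 top `cW` is served for `L ≥ 9` only (✓`…SpreadLiftOfSmallLift`), any top in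
`(0.9483, 1)` for EVERY odd `L ≥ 3`.  The line therefore re-cut `sfCut` to the ramp `(c₁, c₂) = (1∕2, 24∕25)` (token of record:
`∏ p, max 0 (min 1 ((24 ∕ 25 * θ − dist1 (plaqHol U p)) ∕ ((24 ∕ 25 − 1 ∕ 2) * θ)))`), and the (A)-currency files are re-issued with the window
constant a FREE real `cW` in place of the literal `3 ∕ 4` (consumers instantiate `cW := 24 ∕ 25`; `cW := 3 ∕ 4` recovers the landed edition).

CONTENT (as in the landed knit, with `¾ ↦ cW`): for a continuous cutoff `χ ≥ 0` supported in and positive on `{PlaqSmall (cW·θ_{j+1})}` and the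
letters (A1) window-continuity of `V ↦ ∫ f dλ_V` for continuous `f` supported in the `cW`-window, (A2) `λ_V {PlaqSmall (cW·θ_{j+1})} > 0` on
`window_j`, (A3) `∫ f dσ₀_V = c(V)·∫ f dλ_V` (`0 < c(V)`) for `descend_* dU_{j+1}`-a.e. window `V`, for ONE disintegration `σ₀`:
★`fibreMeanVersion_of_regularSmallFieldDisintegration` (density-identity transfer) and ★★`…_ac` (`≪`-form transfer for the SMOOTH tower cut of
O1 v17.x) give VER∘'s per-height conclusion for EVERY disintegration `σ`; the cut-free transfer lemma ✓`OrganTangentFibreMeanVersionKnit.ae_on_of_ae_map_of_ac_of_map_eq` is IMPORTED from the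
landed knit, not re-declared.  Ingredients: ✓`…OrganTangentFibreMeanTools` (a.e. uniqueness of disintegrations, null-set transfer, localisation).
[cite: Balaban1985Averaging, (10)-(13) p.19; Balaban1987RG1, (0.13) p.254]

HONEST FRAMING: a mechanical generalisation (`3 ∕ 4 ↦ cW`) of a landed, kernel-checked helper over hypothesis letters; nothing of Bałaban's
analysis is asserted or proved; (A), VER∘ (as a row), LIN∘, JEN∘, O1, crux 20520 `FluctuationComparisonRegPrIntL`, `YM3TorusSU2` are NOT proved; the
registry `Lines/semiclassical_s2beta.lean` v11.4 (★★OWNER RULING №36) is untouched and nothing here is registered; rung R3 = SU(2) YM₃ on T³ —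
NOT d = 4, NOT infinite volume, NOT a mass gap, NOT Clay; the Yang–Mills mass gap is NOT proved by any of this.
-/

set_option autoImplicit false

noncomputable section

namespace Summit.QuantumFields.YangMills.Theorems.OrganTangentFibreMeanVersionKnitAnyCut

open MeasureTheory ProbabilityTheory Filter Topology Set
open scoped ENNReal
open Literature.MathematicalPhysics.QuantumFieldTheory.Balaban1983to89
open T3ContinuumYM3Torus T3NestedUnitLaws T3UnitLawDensityEML T3UnitScaleTilt
open Literature.MathematicalPhysics.QuantumFieldTheory.Balaban1983to89.T3OrbitAverage
open Summit.QuantumFields.YangMills.Theorems.OrganTangentFibreMeanTools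
open Summit.QuantumFields.YangMills.BalabanUVNodes.N09DomAltThresholdNull (isOpen_setOf_plaqSmall_SU)

/-- ★ **VER∘ FROM A REGULAR SMALL-FIELD DISINTEGRATION OF `descend`.**  In O1's frame at heights `j, j+1` — `r, r′` the height-`(j+1)`
densities (positive and continuous on the fine window `{PlaqSmall θ_{j+1}}`, `0 < θ_{j+1}`), `rj` the height-`j` density of the unprimed tower
(measurable, positive on `window_j`) with the consistency∕density identity `(r·dU_{j+1}).map descend = rj·dU_j` — and for a continuous cutoff
`χ ≥ 0` supported in and positive on `{PlaqSmall (cW·θ_{j+1})}`: the letters (A1)(A2)(A3) for ONE disintegration `σ₀`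
and a family `λ` give, for EVERY disintegration `σ` of `dU_{j+1}` along `descend`, a `window_j`-continuous `m` with `χ·(log r − log r′)·r′`
`σ_V`-integrable and `m V = (∫ χ (log r − log r′) r′ dσ_V) / (∫ χ r′ dσ_V)` for `dU_j`-a.e. `V ∈ window_j` — the per-height conclusion of VER∘ (v2.2–v2.6 body; v2.6 at `cW := 24∕25`)
(«organ_tangent», `Lines/organ_tangent.lean`) at `χ := sfCut θ_{j+1}`, `r := ρ (j+1)`, `r′ := ρ′ (j+1)`, `rj := ρ j`.
[cite: Balaban1985Averaging, (10)-(13) p.19; Balaban1987RG1, (0.13) p.254] -/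
theorem fibreMeanVersion_of_regularSmallFieldDisintegration
    (F : T3Family) (γ b₀ p₀ : ℝ) (j : ℕ) (hθ : 0 < θBal F.L γ b₀ p₀ (j + 1)) (cW : ℝ) (hcW : cW < 1)
    (r r' : GaugeField (F.P (j + 1)) 0 ↥(Matrix.specialUnitaryGroup (Fin 2) ℂ) → ℝ)
    (rj : GaugeField (F.P j) 0 ↥(Matrix.specialUnitaryGroup (Fin 2) ℂ) → ℝ)
    (hpos : ∀ U, PlaqSmall (θBal F.L γ b₀ p₀ (j + 1)) U → 0 < r U ∧ 0 < r' U)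
    (hr : ContinuousOn r {U | PlaqSmall (θBal F.L γ b₀ p₀ (j + 1)) U})
    (hr' : ContinuousOn r' {U | PlaqSmall (θBal F.L γ b₀ p₀ (j + 1)) U})
    (hrj : Measurable rj) (hrjpos : ∀ V, PlaqSmall (θBal F.L γ b₀ p₀ j) V → 0 < rj V)
    (hcons : ((fieldMeasure (F.P (j + 1)) 0 ↥(Matrix.specialUnitaryGroup (Fin 2) ℂ)).withDensity
        (fun U => ENNReal.ofReal (r U))).map (descend F ℰp j) =
      (fieldMeasure (F.P j) 0 ↥(Matrix.specialUnitaryGroup (Fin 2) ℂ)).withDensity (fun V => ENNReal.ofReal (rj V)))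
    (σ : Kernel (GaugeField (F.P j) 0 ↥(Matrix.specialUnitaryGroup (Fin 2) ℂ))
      (GaugeField (F.P (j + 1)) 0 ↥(Matrix.specialUnitaryGroup (Fin 2) ℂ)))
    (hσM : IsMarkovKernel σ)
    (hbind : (Measure.map (descend F ℰp j) (fieldMeasure (F.P (j + 1)) 0 ↥(Matrix.specialUnitaryGroup (Fin 2) ℂ))).bind ⇑σ =
      fieldMeasure (F.P (j + 1)) 0 ↥(Matrix.specialUnitaryGroup (Fin 2) ℂ))
    (hfib : ∀ᵐ V ∂(Measure.map (descend F ℰp j) (fieldMeasure (F.P (j + 1)) 0 ↥(Matrix.specialUnitaryGroup (Fin 2) ℂ))),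
      ∀ᵐ U ∂(σ V), descend F ℰp j U = V)
    (χ : GaugeField (F.P (j + 1)) 0 ↥(Matrix.specialUnitaryGroup (Fin 2) ℂ) → ℝ) (hχc : Continuous χ) (hχ0 : ∀ U, 0 ≤ χ U)
    (hχsupp : ∀ U, χ U ≠ 0 → PlaqSmall (cW * θBal F.L γ b₀ p₀ (j + 1)) U)
    (hχpos : ∀ U, PlaqSmall (cW * θBal F.L γ b₀ p₀ (j + 1)) U → 0 < χ U)
    (σ₀ : Kernel (GaugeField (F.P j) 0 ↥(Matrix.specialUnitaryGroup (Fin 2) ℂ))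
      (GaugeField (F.P (j + 1)) 0 ↥(Matrix.specialUnitaryGroup (Fin 2) ℂ)))
    (hσ₀M : IsMarkovKernel σ₀)
    (hbind₀ : (Measure.map (descend F ℰp j) (fieldMeasure (F.P (j + 1)) 0 ↥(Matrix.specialUnitaryGroup (Fin 2) ℂ))).bind ⇑σ₀ =
      fieldMeasure (F.P (j + 1)) 0 ↥(Matrix.specialUnitaryGroup (Fin 2) ℂ))
    (hfib₀ : ∀ᵐ V ∂(Measure.map (descend F ℰp j) (fieldMeasure (F.P (j + 1)) 0 ↥(Matrix.specialUnitaryGroup (Fin 2) ℂ))),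
      ∀ᵐ U ∂(σ₀ V), descend F ℰp j U = V)
    (lam : GaugeField (F.P j) 0 ↥(Matrix.specialUnitaryGroup (Fin 2) ℂ) →
      Measure (GaugeField (F.P (j + 1)) 0 ↥(Matrix.specialUnitaryGroup (Fin 2) ℂ)))
    (hlam : ∀ V, IsFiniteMeasure (lam V))
    (hA1 : ∀ f : GaugeField (F.P (j + 1)) 0 ↥(Matrix.specialUnitaryGroup (Fin 2) ℂ) → ℝ, Continuous f →
      (∀ U, f U ≠ 0 → PlaqSmall (cW * θBal F.L γ b₀ p₀ (j + 1)) U) →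
      ContinuousOn (fun V => ∫ U, f U ∂(lam V)) {V | PlaqSmall (θBal F.L γ b₀ p₀ j) V})
    (hA2 : ∀ V, PlaqSmall (θBal F.L γ b₀ p₀ j) V → 0 < lam V {U | PlaqSmall (cW * θBal F.L γ b₀ p₀ (j + 1)) U})
    (hA3 : ∃ c : GaugeField (F.P j) 0 ↥(Matrix.specialUnitaryGroup (Fin 2) ℂ) → ℝ,
      ∀ f : GaugeField (F.P (j + 1)) 0 ↥(Matrix.specialUnitaryGroup (Fin 2) ℂ) → ℝ, Continuous f →
        (∀ U, ¬ PlaqSmall (cW * θBal F.L γ b₀ p₀ (j + 1)) U → f U = 0) →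
        ∀ᵐ V ∂(Measure.map (descend F ℰp j) (fieldMeasure (F.P (j + 1)) 0 ↥(Matrix.specialUnitaryGroup (Fin 2) ℂ))),
          PlaqSmall (θBal F.L γ b₀ p₀ j) V → 0 < c V ∧ ∫ U, f U ∂(σ₀ V) = c V * ∫ U, f U ∂(lam V)) :
    ∃ m : GaugeField (F.P j) 0 ↥(Matrix.specialUnitaryGroup (Fin 2) ℂ) → ℝ,
      ContinuousOn m {V | PlaqSmall (θBal F.L γ b₀ p₀ j) V} ∧
      (∀ᵐ V ∂(fieldMeasure (F.P j) 0 ↥(Matrix.specialUnitaryGroup (Fin 2) ℂ)), PlaqSmall (θBal F.L γ b₀ p₀ j) V →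
        Integrable (fun U => χ U * (Real.log (r U) - Real.log (r' U)) * r' U) (σ V) ∧
        m V = (∫ U, χ U * (Real.log (r U) - Real.log (r' U)) * r' U ∂(σ V)) / (∫ U, χ U * r' U ∂(σ V))) := by
  haveI := hσM
  haveI := hσ₀M
  haveI : BorelSpace (GaugeField (F.P (j + 1)) 0 ↥(Matrix.specialUnitaryGroup (Fin 2) ℂ)) :=
    T3OrbitAverage.instBorelSpaceGaugeField
  -- abbreviations
  set θ' : ℝ := θBal F.L γ b₀ p₀ (j + 1) with hθ'
  set θj : ℝ := θBal F.L γ b₀ p₀ j with hθj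
  set Hf : Measure (GaugeField (F.P (j + 1)) 0 ↥(Matrix.specialUnitaryGroup (Fin 2) ℂ)) :=
    fieldMeasure (F.P (j + 1)) 0 ↥(Matrix.specialUnitaryGroup (Fin 2) ℂ) with hHf
  set Hc : Measure (GaugeField (F.P j) 0 ↥(Matrix.specialUnitaryGroup (Fin 2) ℂ)) :=
    fieldMeasure (F.P j) 0 ↥(Matrix.specialUnitaryGroup (Fin 2) ℂ) with hHc
  haveI : IsProbabilityMeasure Hf := Missing.isProbabilityMeasure_fieldMeasure _ _
  haveI : Nonempty (GaugeField (F.P (j + 1)) 0 ↥(Matrix.specialUnitaryGroup (Fin 2) ℂ)) := ⟨fun _ => 1⟩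
  have hd : Measurable (descend F ℰp j :
      GaugeField (F.P (j + 1)) 0 ↥(Matrix.specialUnitaryGroup (Fin 2) ℂ) →
        GaugeField (F.P j) 0 ↥(Matrix.specialUnitaryGroup (Fin 2) ℂ)) :=
    T3NestedUnitLaws.measurable_descend F ℰp measurableE_ℰp j
  -- the windows
  set O : Set (GaugeField (F.P (j + 1)) 0 ↥(Matrix.specialUnitaryGroup (Fin 2) ℂ)) := {U | PlaqSmall θ' U} with hO
  set O₃ : Set (GaugeField (F.P (j + 1)) 0 ↥(Matrix.specialUnitaryGroup (Fin 2) ℂ)) := {U | PlaqSmall (cW * θ') U} with hO₃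
  set W : Set (GaugeField (F.P j) 0 ↥(Matrix.specialUnitaryGroup (Fin 2) ℂ)) := {V | PlaqSmall θj V} with hW
  have hOopen : IsOpen O := isOpen_setOf_plaqSmall_SU 2 (F.P (j + 1)) 0 θ'
  have hχts : tsupport χ ⊆ O := tsupport_subset_plaqSmall (mul_lt_of_lt_one_left hθ hcW) hχsupp
  have hO₃O : O₃ ⊆ O := fun U hU p => (hU p).trans (mul_lt_of_lt_one_left hθ hcW)
  -- the two localised integrands, globally continuous
  set g : GaugeField (F.P (j + 1)) 0 ↥(Matrix.specialUnitaryGroup (Fin 2) ℂ) → ℝ :=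
    fun U => (Real.log (r U) - Real.log (r' U)) * r' U with hg
  have hgc : ContinuousOn g O :=
    ((hr.log fun U hU => (hpos U hU).1.ne').sub (hr'.log fun U hU => (hpos U hU).2.ne')).mul hr'
  set f₁ : GaugeField (F.P (j + 1)) 0 ↥(Matrix.specialUnitaryGroup (Fin 2) ℂ) → ℝ := fun U => χ U * g U with hf₁
  set f₂ : GaugeField (F.P (j + 1)) 0 ↥(Matrix.specialUnitaryGroup (Fin 2) ℂ) → ℝ := fun U => χ U * r' U with hf₂
  have hf₁c : Continuous f₁ := continuous_mul_of_tsupport_subset hOopen hχc hχts hgc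
  have hf₂c : Continuous f₂ := continuous_mul_of_tsupport_subset hOopen hχc hχts hr'
  have hf₁eq : (fun U => χ U * (Real.log (r U) - Real.log (r' U)) * r' U) = f₁ := by
    funext U; simp only [hf₁, hg]; ring
  have hf₁supp : ∀ U, f₁ U ≠ 0 → PlaqSmall (cW * θ') U := fun U hU => hχsupp U (left_ne_zero_of_mul hU)
  have hf₂supp : ∀ U, f₂ U ≠ 0 → PlaqSmall (cW * θ') U := fun U hU => hχsupp U (left_ne_zero_of_mul hU)
  have hf₁zero : ∀ U, U ∉ O₃ → f₁ U = 0 := fun U hU => by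
    by_contra h; exact hU (hf₁supp U h)
  have hf₂zero : ∀ U, U ∉ O₃ → f₂ U = 0 := fun U hU => by
    by_contra h; exact hU (hf₂supp U h)
  have hf₂nn : ∀ U, 0 ≤ f₂ U := by
    intro U
    by_cases hU : χ U = 0
    · simp only [hf₂, hU, zero_mul, le_refl]
    · exact mul_nonneg (hχ0 U) (hpos U (hO₃O (hχsupp U hU))).2.le
  have hf₂O₃ : ∀ U, U ∈ O₃ → f₂ U ≠ 0 := fun U hU =>
    mul_ne_zero (hχpos U hU).ne' (hpos U (hO₃O hU)).2.ne'
  -- the version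
  set num : GaugeField (F.P j) 0 ↥(Matrix.specialUnitaryGroup (Fin 2) ℂ) → ℝ := fun V => ∫ U, f₁ U ∂(lam V) with hnum
  set den : GaugeField (F.P j) 0 ↥(Matrix.specialUnitaryGroup (Fin 2) ℂ) → ℝ := fun V => ∫ U, f₂ U ∂(lam V) with hden
  have hnumc : ContinuousOn num W := hA1 f₁ hf₁c hf₁supp
  have hdenc : ContinuousOn den W := hA1 f₂ hf₂c hf₂supp
  have hdenpos : ∀ V, V ∈ W → 0 < den V := by
    intro V hV
    haveI := hlam V
    have hint : Integrable f₂ (lam V) := integrable_of_continuous_compact hf₂c (lam V)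
    rw [hden]
    refine (integral_pos_iff_support_of_nonneg_ae (Eventually.of_forall hf₂nn) hint).mpr ?_
    exact (hA2 V hV).trans_le (measure_mono fun U hU => Function.mem_support.mpr (hf₂O₃ U hU))
  refine ⟨fun V => num V / den V, hnumc.div hdenc fun V hV => (hdenpos V hV).ne', ?_⟩
  -- uniqueness of the disintegration: σ = σ₀ a.e.
  have huniq : ∀ᵐ V ∂(Hf.map (descend F ℰp j)), σ V = σ₀ V :=
    ae_eq_of_bind_of_bind Hf hd σ σ₀ hbind hfib hbind₀ hfib₀
  -- the identity, `descend_* dU_{j+1}`-a.e. on the window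
  have hkey : ∀ᵐ V ∂(Hf.map (descend F ℰp j)), V ∈ W →
      (Integrable (fun U => χ U * (Real.log (r U) - Real.log (r' U)) * r' U) (σ V) ∧
        num V / den V = (∫ U, χ U * (Real.log (r U) - Real.log (r' U)) * r' U ∂(σ V)) / (∫ U, χ U * r' U ∂(σ V))) := by
    obtain ⟨c, hc⟩ := hA3
    filter_upwards [huniq, hc f₁ hf₁c hf₁zero, hc f₂ hf₂c hf₂zero] with V hVσ hV1 hV2
    intro hVW
    refine ⟨?_, ?_⟩
    · rw [hf₁eq]; exact integrable_of_continuous_compact hf₁c (σ V)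
    obtain ⟨hc0, hres1⟩ := hV1 hVW
    obtain ⟨-, hres2⟩ := hV2 hVW
    rw [hf₁eq, show (fun U => χ U * r' U) = f₂ from rfl, hVσ, hres1, hres2, mul_div_mul_left _ _ hc0.ne']
  -- transfer `descend_* dU_{j+1}`-a.e. ⇒ `dU_j`-a.e. on the window through the density identity
  have hWne : ∀ V ∈ W, ENNReal.ofReal (rj V) ≠ 0 := fun V hV => (ENNReal.ofReal_pos.mpr (hrjpos V hV)).ne'
  have hρX : AEMeasurable (fun V => ENNReal.ofReal (rj V)) Hc := (ENNReal.measurable_ofReal.comp hrj).aemeasurable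
  have := ae_on_of_ae_map_of_withDensity_eq Hf hd Hc (fun U => ENNReal.ofReal (r U)) hρX hcons hWne hkey
  filter_upwards [this] with V hV hVW
  exact hV hVW hVW

/-! ## v4 (2026-08-30, frame O1 v17.1 ∕ rows v2.5 — SMOOTH TOWER CUT): the transfer hypothesis in `≪`-form

In the CUT regime `j < Ts` of O1 v17.1 (`runpair_organ.v171.lean` c91ed6b9e7fcccb1; rows `organ_tangent.v25.lean` 73ebf91b6cf8441c) the frame
hands height `j` the identity `rj·dU_j = descend_* ((r·dU_{j+1}).withDensity (sfCut θ_{j+1}))` instead of v16's `rj·dU_j = descend_* (r·dU_{j+1})`.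
The knit uses that identity ONLY to move a `descend_* dU_{j+1}`-a.e. statement to a `dU_j`-a.e. statement on the window, which needs no more
than SOME measure `mY ≪ dU_{j+1}` with `mY.map descend = rj·dU_j`, `rj > 0` on the window.  ★`fibreMeanVersion_of_regularSmallFieldDisintegration_ac`
is v3's theorem with `hcons` so weakened (conclusion byte-identical); v3 is its instance `mY := r·dU_{j+1}`, the cut regime its instance
`mY := (r·dU_{j+1}).withDensity (ofReal ∘ sfCut θ_{j+1})`, the uncut regime `Ts ≤ j` again `mY := r·dU_{j+1}`. -/

/-- ★ **VER∘ FROM A REGULAR SMALL-FIELD DISINTEGRATION OF `descend` — `≪`-FORM TRANSFER (v4, frame O1 v17.1 ∕ rows v2.5).**  As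
★`fibreMeanVersion_of_regularSmallFieldDisintegration`, with the consistency∕density identity replaced by: SOME measure `mY ≪ dU_{j+1}` on fine
fields with `mY.map descend = rj·dU_j` (`rj` measurable, positive on `window_j`).  Instances: `mY := r·dU_{j+1}` (uncut step `Ts ≤ j`, and v3),
`mY := (ρ_{j+1}·dU_{j+1}).withDensity (ofReal ∘ sfCut θ_{j+1})` (cut step `j < Ts` of O1 v17.1: `μ_j = descend_* (sfCut θ_{j+1} · μ_{j+1})`).
Conclusion byte-identical with v3: for EVERY disintegration `σ` of `dU_{j+1}` along `descend`, a `window_j`-continuous `m` with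
`χ·(log r − log r′)·r′` `σ_V`-integrable and `m V = (∫ χ (log r − log r′) r′ dσ_V) / (∫ χ r′ dσ_V)` for `dU_j`-a.e. `V ∈ window_j`.
[cite: Balaban1985Averaging, (10)-(13) p.19; Balaban1987RG1, (0.13) p.254] -/
theorem fibreMeanVersion_of_regularSmallFieldDisintegration_ac
    (F : T3Family) (γ b₀ p₀ : ℝ) (j : ℕ) (hθ : 0 < θBal F.L γ b₀ p₀ (j + 1)) (cW : ℝ) (hcW : cW < 1)
    (r r' : GaugeField (F.P (j + 1)) 0 ↥(Matrix.specialUnitaryGroup (Fin 2) ℂ) → ℝ)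
    (rj : GaugeField (F.P j) 0 ↥(Matrix.specialUnitaryGroup (Fin 2) ℂ) → ℝ)
    (hpos : ∀ U, PlaqSmall (θBal F.L γ b₀ p₀ (j + 1)) U → 0 < r U ∧ 0 < r' U)
    (hr : ContinuousOn r {U | PlaqSmall (θBal F.L γ b₀ p₀ (j + 1)) U})
    (hr' : ContinuousOn r' {U | PlaqSmall (θBal F.L γ b₀ p₀ (j + 1)) U})
    (hrj : Measurable rj) (hrjpos : ∀ V, PlaqSmall (θBal F.L γ b₀ p₀ j) V → 0 < rj V)
    (mY : Measure (GaugeField (F.P (j + 1)) 0 ↥(Matrix.specialUnitaryGroup (Fin 2) ℂ)))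
    (hmY : mY ≪ fieldMeasure (F.P (j + 1)) 0 ↥(Matrix.specialUnitaryGroup (Fin 2) ℂ))
    (hcons : mY.map (descend F ℰp j) =
      (fieldMeasure (F.P j) 0 ↥(Matrix.specialUnitaryGroup (Fin 2) ℂ)).withDensity (fun V => ENNReal.ofReal (rj V)))
    (σ : Kernel (GaugeField (F.P j) 0 ↥(Matrix.specialUnitaryGroup (Fin 2) ℂ))
      (GaugeField (F.P (j + 1)) 0 ↥(Matrix.specialUnitaryGroup (Fin 2) ℂ)))
    (hσM : IsMarkovKernel σ)
    (hbind : (Measure.map (descend F ℰp j) (fieldMeasure (F.P (j + 1)) 0 ↥(Matrix.specialUnitaryGroup (Fin 2) ℂ))).bind ⇑σ =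
      fieldMeasure (F.P (j + 1)) 0 ↥(Matrix.specialUnitaryGroup (Fin 2) ℂ))
    (hfib : ∀ᵐ V ∂(Measure.map (descend F ℰp j) (fieldMeasure (F.P (j + 1)) 0 ↥(Matrix.specialUnitaryGroup (Fin 2) ℂ))),
      ∀ᵐ U ∂(σ V), descend F ℰp j U = V)
    (χ : GaugeField (F.P (j + 1)) 0 ↥(Matrix.specialUnitaryGroup (Fin 2) ℂ) → ℝ) (hχc : Continuous χ) (hχ0 : ∀ U, 0 ≤ χ U)
    (hχsupp : ∀ U, χ U ≠ 0 → PlaqSmall (cW * θBal F.L γ b₀ p₀ (j + 1)) U)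
    (hχpos : ∀ U, PlaqSmall (cW * θBal F.L γ b₀ p₀ (j + 1)) U → 0 < χ U)
    (σ₀ : Kernel (GaugeField (F.P j) 0 ↥(Matrix.specialUnitaryGroup (Fin 2) ℂ))
      (GaugeField (F.P (j + 1)) 0 ↥(Matrix.specialUnitaryGroup (Fin 2) ℂ)))
    (hσ₀M : IsMarkovKernel σ₀)
    (hbind₀ : (Measure.map (descend F ℰp j) (fieldMeasure (F.P (j + 1)) 0 ↥(Matrix.specialUnitaryGroup (Fin 2) ℂ))).bind ⇑σ₀ =
      fieldMeasure (F.P (j + 1)) 0 ↥(Matrix.specialUnitaryGroup (Fin 2) ℂ))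
    (hfib₀ : ∀ᵐ V ∂(Measure.map (descend F ℰp j) (fieldMeasure (F.P (j + 1)) 0 ↥(Matrix.specialUnitaryGroup (Fin 2) ℂ))),
      ∀ᵐ U ∂(σ₀ V), descend F ℰp j U = V)
    (lam : GaugeField (F.P j) 0 ↥(Matrix.specialUnitaryGroup (Fin 2) ℂ) →
      Measure (GaugeField (F.P (j + 1)) 0 ↥(Matrix.specialUnitaryGroup (Fin 2) ℂ)))
    (hlam : ∀ V, IsFiniteMeasure (lam V))
    (hA1 : ∀ f : GaugeField (F.P (j + 1)) 0 ↥(Matrix.specialUnitaryGroup (Fin 2) ℂ) → ℝ, Continuous f →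
      (∀ U, f U ≠ 0 → PlaqSmall (cW * θBal F.L γ b₀ p₀ (j + 1)) U) →
      ContinuousOn (fun V => ∫ U, f U ∂(lam V)) {V | PlaqSmall (θBal F.L γ b₀ p₀ j) V})
    (hA2 : ∀ V, PlaqSmall (θBal F.L γ b₀ p₀ j) V → 0 < lam V {U | PlaqSmall (cW * θBal F.L γ b₀ p₀ (j + 1)) U})
    (hA3 : ∃ c : GaugeField (F.P j) 0 ↥(Matrix.specialUnitaryGroup (Fin 2) ℂ) → ℝ,
      ∀ f : GaugeField (F.P (j + 1)) 0 ↥(Matrix.specialUnitaryGroup (Fin 2) ℂ) → ℝ, Continuous f →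
        (∀ U, ¬ PlaqSmall (cW * θBal F.L γ b₀ p₀ (j + 1)) U → f U = 0) →
        ∀ᵐ V ∂(Measure.map (descend F ℰp j) (fieldMeasure (F.P (j + 1)) 0 ↥(Matrix.specialUnitaryGroup (Fin 2) ℂ))),
          PlaqSmall (θBal F.L γ b₀ p₀ j) V → 0 < c V ∧ ∫ U, f U ∂(σ₀ V) = c V * ∫ U, f U ∂(lam V)) :
    ∃ m : GaugeField (F.P j) 0 ↥(Matrix.specialUnitaryGroup (Fin 2) ℂ) → ℝ,
      ContinuousOn m {V | PlaqSmall (θBal F.L γ b₀ p₀ j) V} ∧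
      (∀ᵐ V ∂(fieldMeasure (F.P j) 0 ↥(Matrix.specialUnitaryGroup (Fin 2) ℂ)), PlaqSmall (θBal F.L γ b₀ p₀ j) V →
        Integrable (fun U => χ U * (Real.log (r U) - Real.log (r' U)) * r' U) (σ V) ∧
        m V = (∫ U, χ U * (Real.log (r U) - Real.log (r' U)) * r' U ∂(σ V)) / (∫ U, χ U * r' U ∂(σ V))) := by
  haveI := hσM
  haveI := hσ₀M
  haveI : BorelSpace (GaugeField (F.P (j + 1)) 0 ↥(Matrix.specialUnitaryGroup (Fin 2) ℂ)) :=
    T3OrbitAverage.instBorelSpaceGaugeField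
  -- abbreviations
  set θ' : ℝ := θBal F.L γ b₀ p₀ (j + 1) with hθ'
  set θj : ℝ := θBal F.L γ b₀ p₀ j with hθj
  set Hf : Measure (GaugeField (F.P (j + 1)) 0 ↥(Matrix.specialUnitaryGroup (Fin 2) ℂ)) :=
    fieldMeasure (F.P (j + 1)) 0 ↥(Matrix.specialUnitaryGroup (Fin 2) ℂ) with hHf
  set Hc : Measure (GaugeField (F.P j) 0 ↥(Matrix.specialUnitaryGroup (Fin 2) ℂ)) :=
    fieldMeasure (F.P j) 0 ↥(Matrix.specialUnitaryGroup (Fin 2) ℂ) with hHc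
  haveI : IsProbabilityMeasure Hf := Missing.isProbabilityMeasure_fieldMeasure _ _
  haveI : Nonempty (GaugeField (F.P (j + 1)) 0 ↥(Matrix.specialUnitaryGroup (Fin 2) ℂ)) := ⟨fun _ => 1⟩
  have hd : Measurable (descend F ℰp j :
      GaugeField (F.P (j + 1)) 0 ↥(Matrix.specialUnitaryGroup (Fin 2) ℂ) →
        GaugeField (F.P j) 0 ↥(Matrix.specialUnitaryGroup (Fin 2) ℂ)) :=
    T3NestedUnitLaws.measurable_descend F ℰp measurableE_ℰp j
  -- the windows
  set O : Set (GaugeField (F.P (j + 1)) 0 ↥(Matrix.specialUnitaryGroup (Fin 2) ℂ)) := {U | PlaqSmall θ' U} with hO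
  set O₃ : Set (GaugeField (F.P (j + 1)) 0 ↥(Matrix.specialUnitaryGroup (Fin 2) ℂ)) := {U | PlaqSmall (cW * θ') U} with hO₃
  set W : Set (GaugeField (F.P j) 0 ↥(Matrix.specialUnitaryGroup (Fin 2) ℂ)) := {V | PlaqSmall θj V} with hW
  have hOopen : IsOpen O := isOpen_setOf_plaqSmall_SU 2 (F.P (j + 1)) 0 θ'
  have hχts : tsupport χ ⊆ O := tsupport_subset_plaqSmall (mul_lt_of_lt_one_left hθ hcW) hχsupp
  have hO₃O : O₃ ⊆ O := fun U hU p => (hU p).trans (mul_lt_of_lt_one_left hθ hcW)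
  -- the two localised integrands, globally continuous
  set g : GaugeField (F.P (j + 1)) 0 ↥(Matrix.specialUnitaryGroup (Fin 2) ℂ) → ℝ :=
    fun U => (Real.log (r U) - Real.log (r' U)) * r' U with hg
  have hgc : ContinuousOn g O :=
    ((hr.log fun U hU => (hpos U hU).1.ne').sub (hr'.log fun U hU => (hpos U hU).2.ne')).mul hr'
  set f₁ : GaugeField (F.P (j + 1)) 0 ↥(Matrix.specialUnitaryGroup (Fin 2) ℂ) → ℝ := fun U => χ U * g U with hf₁
  set f₂ : GaugeField (F.P (j + 1)) 0 ↥(Matrix.specialUnitaryGroup (Fin 2) ℂ) → ℝ := fun U => χ U * r' U with hf₂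
  have hf₁c : Continuous f₁ := continuous_mul_of_tsupport_subset hOopen hχc hχts hgc
  have hf₂c : Continuous f₂ := continuous_mul_of_tsupport_subset hOopen hχc hχts hr'
  have hf₁eq : (fun U => χ U * (Real.log (r U) - Real.log (r' U)) * r' U) = f₁ := by
    funext U; simp only [hf₁, hg]; ring
  have hf₁supp : ∀ U, f₁ U ≠ 0 → PlaqSmall (cW * θ') U := fun U hU => hχsupp U (left_ne_zero_of_mul hU)
  have hf₂supp : ∀ U, f₂ U ≠ 0 → PlaqSmall (cW * θ') U := fun U hU => hχsupp U (left_ne_zero_of_mul hU)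
  have hf₁zero : ∀ U, U ∉ O₃ → f₁ U = 0 := fun U hU => by
    by_contra h; exact hU (hf₁supp U h)
  have hf₂zero : ∀ U, U ∉ O₃ → f₂ U = 0 := fun U hU => by
    by_contra h; exact hU (hf₂supp U h)
  have hf₂nn : ∀ U, 0 ≤ f₂ U := by
    intro U
    by_cases hU : χ U = 0
    · simp only [hf₂, hU, zero_mul, le_refl]
    · exact mul_nonneg (hχ0 U) (hpos U (hO₃O (hχsupp U hU))).2.le
  have hf₂O₃ : ∀ U, U ∈ O₃ → f₂ U ≠ 0 := fun U hU =>
    mul_ne_zero (hχpos U hU).ne' (hpos U (hO₃O hU)).2.ne'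
  -- the version
  set num : GaugeField (F.P j) 0 ↥(Matrix.specialUnitaryGroup (Fin 2) ℂ) → ℝ := fun V => ∫ U, f₁ U ∂(lam V) with hnum
  set den : GaugeField (F.P j) 0 ↥(Matrix.specialUnitaryGroup (Fin 2) ℂ) → ℝ := fun V => ∫ U, f₂ U ∂(lam V) with hden
  have hnumc : ContinuousOn num W := hA1 f₁ hf₁c hf₁supp
  have hdenc : ContinuousOn den W := hA1 f₂ hf₂c hf₂supp
  have hdenpos : ∀ V, V ∈ W → 0 < den V := by
    intro V hV
    haveI := hlam V
    have hint : Integrable f₂ (lam V) := integrable_of_continuous_compact hf₂c (lam V)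
    rw [hden]
    refine (integral_pos_iff_support_of_nonneg_ae (Eventually.of_forall hf₂nn) hint).mpr ?_
    exact (hA2 V hV).trans_le (measure_mono fun U hU => Function.mem_support.mpr (hf₂O₃ U hU))
  refine ⟨fun V => num V / den V, hnumc.div hdenc fun V hV => (hdenpos V hV).ne', ?_⟩
  -- uniqueness of the disintegration: σ = σ₀ a.e.
  have huniq : ∀ᵐ V ∂(Hf.map (descend F ℰp j)), σ V = σ₀ V :=
    ae_eq_of_bind_of_bind Hf hd σ σ₀ hbind hfib hbind₀ hfib₀
  -- the identity, `descend_* dU_{j+1}`-a.e. on the window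
  have hkey : ∀ᵐ V ∂(Hf.map (descend F ℰp j)), V ∈ W →
      (Integrable (fun U => χ U * (Real.log (r U) - Real.log (r' U)) * r' U) (σ V) ∧
        num V / den V = (∫ U, χ U * (Real.log (r U) - Real.log (r' U)) * r' U ∂(σ V)) / (∫ U, χ U * r' U ∂(σ V))) := by
    obtain ⟨c, hc⟩ := hA3
    filter_upwards [huniq, hc f₁ hf₁c hf₁zero, hc f₂ hf₂c hf₂zero] with V hVσ hV1 hV2
    intro hVW
    refine ⟨?_, ?_⟩
    · rw [hf₁eq]; exact integrable_of_continuous_compact hf₁c (σ V)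
    obtain ⟨hc0, hres1⟩ := hV1 hVW
    obtain ⟨-, hres2⟩ := hV2 hVW
    rw [hf₁eq, show (fun U => χ U * r' U) = f₂ from rfl, hVσ, hres1, hres2, mul_div_mul_left _ _ hc0.ne']
  -- transfer `descend_* dU_{j+1}`-a.e. ⇒ `dU_j`-a.e. on the window through the (≪-form) consistency identity
  have hWne : ∀ V ∈ W, ENNReal.ofReal (rj V) ≠ 0 := fun V hV => (ENNReal.ofReal_pos.mpr (hrjpos V hV)).ne'
  have hρX : AEMeasurable (fun V => ENNReal.ofReal (rj V)) Hc := (ENNReal.measurable_ofReal.comp hrj).aemeasurable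
  have := OrganTangentFibreMeanVersionKnit.ae_on_of_ae_map_of_ac_of_map_eq Hf hd Hc mY hmY hρX hcons hWne hkey
  filter_upwards [this] with V hV hVW
  exact hV hVW hVW

end Summit.QuantumFields.YangMills.Theorems.OrganTangentFibreMeanVersionKnitAnyCut

end
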